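import Summits.Parity.GeneralizedHardyLittlewood.Theses.LiouvilleShiftedTables

/-!
# `PairsHL`: parity of the shift, and elementary estimates

Route `LiouvilleShiftedTables` (Parity / GeneralizedHardyLittlewood), support item stmt-Parity-9387
(`Summit.Parity.GeneralizedHardyLittlewood.Theses.LiouvilleShiftedTables.PairsHL`):
for every `h ≥ 1`, `∑_{n ≤ N} Λ(n) Λ(n+h) = 𝔖({0,h}) N + o(N)`.

For EVEN `h` this is the Hardy–Littlewood prime-pair conjecture (open). This file settles the ODD
shifts unconditionally, records the reduction of the item to its even-shift case, and collects the
elementary facts used by the companion files `…PairsHLBounds` / `…PairsHLStatus`: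

* `singularSeries_pair_eq_zero` — for odd `h`, `ν_{{0,h}}(2) = 2`, so the Euler factor at `p = 2`
  vanishes and `𝔖({0,h}) = 0`;
* `sum_le_of_odd` — for odd `h`, `Λ(n)Λ(n+h) ≠ 0` forces `n` or `n + h` to be a power of two, so
  `∑_{n ≤ N} Λ(n)Λ(n+h) ≤ 2 (log₂(N+h) + 1) log²(N+h)`;
* `pairsHL_odd` — hence the `PairsHL` asymptotic holds at every odd shift (`log³ = o(N)`);
* `pairsHL_iff_even` — `PairsHL ↔` its restriction to even shifts `h ≥ 2`;
* `isAdmissibleTuple_pair_of_even`, `singularSeries_pair_pos_of_even` — for even `h ≥ 2` the pair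
  `{0, h}` is admissible and `𝔖({0,h}) > 0`;
* `eventually_log_add_le`, `eventually_rpow_mul_log_sq_le`, `eventually_properPower_bound_le` —
  `log(N+h) ≤ (1+δ) log N`, `N^{1−δ} log² N ≤ δ N`, `2(√(N+h)+1)(log₂(N+h)+1) log²(N+h) ≤ c N`
  for all large `N`.
-/

open Finset Filter Asymptotics ArithmeticFunction

noncomputable section

namespace Summit.Parity.GeneralizedHardyLittlewood.Theorems.PairsHL

open Literature.NumberTheory.Sieve
open Summit.Parity.GeneralizedHardyLittlewood.Theses.LiouvilleShiftedTables (PairsHL)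

/-! ### The singular series vanishes at odd shifts -/

/-- For odd `h`, the tuple `{0, h}` occupies both residue classes mod `2`: `ν_{{0,h}}(2) = 2`.
[folklore] -/
theorem tupleResidueCount_pair_two {h : ℕ} (hh : Odd h) :
    tupleResidueCount ({0, (h : ℤ)} : Finset ℤ) 2 = 2 := by
  unfold tupleResidueCount
  rw [image_insert, image_singleton, Int.cast_zero, Int.cast_natCast,
    ZMod.natCast_eq_one_iff_odd.mpr hh]
  exact card_pair (by decide)

/-- For odd `h` the Hardy–Littlewood singular series of `{0, h}` vanishes: the Euler factor at
`p = 2` is `(1 - 2/2)(1 - 1/2)⁻² = 0`, so the ordered partial products are eventually `0`.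
[folklore] -/
theorem singularSeries_pair_eq_zero {h : ℕ} (hh : Odd h) :
    singularSeries ({0, (h : ℤ)} : Finset ℤ) = 0 := by
  set H : Finset ℤ := {0, (h : ℤ)} with hH
  have hν : 2 ≤ tupleResidueCount H 2 := (tupleResidueCount_pair_two hh).ge
  have hzero : ∀ x ≥ 2, singularSeriesPartial H x = 0 := fun x hx ↦
    prod_eq_zero (Nat.mem_primesLE.mpr ⟨hx, Nat.prime_two⟩)
      (singularSeriesFactor_eq_zero H Nat.prime_two hν)
  have hlim : Tendsto (singularSeriesPartial H) atTop (nhds 0) :=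
    tendsto_const_nhds.congr' (eventually_atTop.mpr ⟨2, fun x hx ↦ (hzero x hx).symm⟩)
  exact tendsto_nhds_unique (tendsto_singularSeriesPartial_holds H) hlim

/-! ### Support of `Λ(n)Λ(n+h)` for odd `h` -/

/-- An even prime power is a power of two. [folklore] -/
theorem exists_eq_two_pow_of_isPrimePow_of_even {n : ℕ} (hn : IsPrimePow n) (he : Even n) :
    ∃ k, n = 2 ^ k := by
  obtain ⟨p, k, hp, -, rfl⟩ := (isPrimePow_nat_iff _).mp hn
  have h2 : 2 ∣ p := Nat.prime_two.dvd_of_dvd_pow (even_iff_two_dvd.mp he)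
  have hp2 : p = 2 := ((Nat.prime_dvd_prime_iff_eq Nat.prime_two hp).mp h2).symm
  exact ⟨k, by rw [hp2]⟩

/-- If `h` is odd and `Λ(n) Λ(n+h) ≠ 0` then `n` and `n + h` are prime powers of opposite parity,
so one of them is a power of two. [folklore] -/
theorem two_pow_or_two_pow_of_odd {h n : ℕ} (hh : Odd h)
    (hn : vonMangoldt n * vonMangoldt (n + h) ≠ 0) :
    (∃ k, n = 2 ^ k) ∨ (∃ k, n + h = 2 ^ k) := by
  have h1 : IsPrimePow n := vonMangoldt_ne_zero_iff.mp (left_ne_zero_of_mul hn)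
  have h2 : IsPrimePow (n + h) := vonMangoldt_ne_zero_iff.mp (right_ne_zero_of_mul hn)
  rcases Nat.even_or_odd n with he | ho
  · exact Or.inl (exists_eq_two_pow_of_isPrimePow_of_even h1 he)
  · exact Or.inr (exists_eq_two_pow_of_isPrimePow_of_even h2 (ho.add_odd hh))

/-- **Odd shifts, pointwise bound.** For odd `h` and every `N`,
`∑_{n ≤ N} Λ(n) Λ(n+h) ≤ 2 (log₂(N+h) + 1) · log²(N+h)`: the sum is supported on the `n` with `n`
or `n + h` a power of two (at most `2 (log₂(N+h) + 1)` of them), and each term is at most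
`log²(N+h)`. [folklore] -/
theorem sum_le_of_odd {h : ℕ} (hh : Odd h) (N : ℕ) :
    ∑ n ∈ Icc 1 N, vonMangoldt n * vonMangoldt (n + h)
      ≤ 2 * (Nat.log 2 (N + h) + 1) * Real.log ((N + h : ℕ) : ℝ) ^ 2 := by
  set L := Real.log ((N + h : ℕ) : ℝ) with hLdef
  have hL : 0 ≤ L := Real.log_natCast_nonneg _
  set s := (Icc 1 N).filter fun n ↦ vonMangoldt n * vonMangoldt (n + h) ≠ 0 with hs
  have hsum : ∑ n ∈ Icc 1 N, vonMangoldt n * vonMangoldt (n + h)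
      = ∑ n ∈ s, vonMangoldt n * vonMangoldt (n + h) :=
    (sum_filter_ne_zero _).symm
  have hterm : ∀ n ∈ s, vonMangoldt n * vonMangoldt (n + h) ≤ L ^ 2 := by
    intro n hn
    have hn' := mem_Icc.mp (mem_filter.mp hn).1
    have hn0 : (0 : ℝ) < n := by exact_mod_cast hn'.1
    have hnN : (n : ℝ) ≤ ((N + h : ℕ) : ℝ) := by exact_mod_cast (by omega : n ≤ N + h)
    have hnh0 : (0 : ℝ) < ((n + h : ℕ) : ℝ) := by exact_mod_cast (by omega : 0 < n + h)
    have hnhN : ((n + h : ℕ) : ℝ) ≤ ((N + h : ℕ) : ℝ) := by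
      exact_mod_cast (by omega : n + h ≤ N + h)
    have h1 : vonMangoldt n ≤ L := vonMangoldt_le_log.trans (Real.log_le_log hn0 hnN)
    have h2 : vonMangoldt (n + h) ≤ L := vonMangoldt_le_log.trans (Real.log_le_log hnh0 hnhN)
    calc vonMangoldt n * vonMangoldt (n + h) ≤ L * L := mul_le_mul h1 h2 vonMangoldt_nonneg hL
      _ = L ^ 2 := (sq L).symm
  have hcard : #s ≤ 2 * (Nat.log 2 (N + h) + 1) := by
    set K := Nat.log 2 (N + h) with hK
    have hsub : s ⊆ (range (K + 1)).image (2 ^ ·) ∪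
        (range (K + 1)).image (fun k ↦ 2 ^ k - h) := by
      intro n hn
      rw [mem_filter, mem_Icc] at hn
      obtain ⟨⟨-, hnN⟩, hne⟩ := hn
      rw [mem_union, mem_image, mem_image]
      rcases two_pow_or_two_pow_of_odd hh hne with ⟨k, hk⟩ | ⟨k, hk⟩
      · refine Or.inl ⟨k, mem_range.mpr (Nat.lt_succ_of_le ?_), hk.symm⟩
        exact Nat.le_log_of_pow_le one_lt_two (by rw [← hk]; omega)
      · refine Or.inr ⟨k, mem_range.mpr (Nat.lt_succ_of_le ?_), by rw [← hk]; omega⟩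
        exact Nat.le_log_of_pow_le one_lt_two (by rw [← hk]; omega)
    calc #s ≤ #((range (K + 1)).image (2 ^ ·) ∪ (range (K + 1)).image (fun k ↦ 2 ^ k - h)) :=
          card_le_card hsub
      _ ≤ #((range (K + 1)).image (2 ^ ·)) + #((range (K + 1)).image (fun k ↦ 2 ^ k - h)) :=
          card_union_le _ _
      _ ≤ #(range (K + 1)) + #(range (K + 1)) := add_le_add card_image_le card_image_le
      _ = 2 * (K + 1) := by rw [card_range]; ring
  have hcardR : (#s : ℝ) ≤ 2 * (Nat.log 2 (N + h) + 1) := by exact_mod_cast hcard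
  calc ∑ n ∈ Icc 1 N, vonMangoldt n * vonMangoldt (n + h)
        = ∑ n ∈ s, vonMangoldt n * vonMangoldt (n + h) := hsum
    _ ≤ ∑ _n ∈ s, L ^ 2 := sum_le_sum hterm
    _ = #s * L ^ 2 := by rw [sum_const, nsmul_eq_mul]
    _ ≤ 2 * (Nat.log 2 (N + h) + 1) * L ^ 2 := by gcongr

/-- `log₂ M ≤ 2 log M` (crude: `2^{log₂ M} ≤ M` and `log 2 > 1/2`). [folklore] -/
theorem natLog_two_le (M : ℕ) : (Nat.log 2 M : ℝ) ≤ 2 * Real.log M := by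
  rcases Nat.eq_zero_or_pos M with rfl | hM
  · simp
  · have h := Real.le_log_of_pow_le (by norm_num : (0 : ℝ) < 2)
      (show (2 : ℝ) ^ Nat.log 2 M ≤ M by exact_mod_cast Nat.pow_log_le_self 2 hM.ne')
    have hlog2 : (1 : ℝ) / 2 < Real.log 2 := by linarith [Real.log_two_gt_d9]
    have hlogM : 0 ≤ Real.log M := Real.log_natCast_nonneg M
    nlinarith [hlog2, h, hlogM, (Nat.cast_nonneg (Nat.log 2 M) : (0 : ℝ) ≤ _)]

/-! ### `PairsHL` at odd shifts -/

/-- **`PairsHL` at odd shifts.** For odd `h`, `𝔖({0,h}) = 0` and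
`∑_{n ≤ N} Λ(n)Λ(n+h) ≤ 6 log³(N+h) = o(N)`, so the Hardy–Littlewood pair asymptotic
`∑_{n ≤ N} Λ(n)Λ(n+h) = 𝔖({0,h}) N + o(N)` holds unconditionally at every odd shift. [folklore] -/
theorem pairsHL_odd {h : ℕ} (hh : Odd h) :
    (fun N : ℕ => ∑ n ∈ Finset.Icc 1 N, ArithmeticFunction.vonMangoldt n *
        ArithmeticFunction.vonMangoldt (n + h)
        - Literature.NumberTheory.Sieve.singularSeries ({0, (h : ℤ)} : Finset ℤ) * N)
      =o[Filter.atTop] fun N : ℕ => (N : ℝ) := by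
  simp only [singularSeries_pair_eq_zero hh, zero_mul, sub_zero]
  have hA : (fun N : ℕ => ∑ n ∈ Icc 1 N, vonMangoldt n * vonMangoldt (n + h))
      =O[atTop] fun N : ℕ => Real.log ((N + h : ℕ) : ℝ) ^ 3 := by
    refine IsBigO.of_bound 6 ?_
    filter_upwards [eventually_ge_atTop 3] with N hN
    have h3 : (3 : ℝ) ≤ ((N + h : ℕ) : ℝ) := by exact_mod_cast (by omega : 3 ≤ N + h)
    have hL1 : 1 ≤ Real.log ((N + h : ℕ) : ℝ) := by
      have := Real.log_le_log (Real.exp_pos 1)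
        ((show Real.exp 1 ≤ (3 : ℝ) by linarith [Real.exp_one_lt_d9]).trans h3)
      rwa [Real.log_exp] at this
    have hlog : (Nat.log 2 (N + h) : ℝ) ≤ 2 * Real.log ((N + h : ℕ) : ℝ) :=
      natLog_two_le (N + h)
    set L := Real.log ((N + h : ℕ) : ℝ) with hLdef
    have hsum_nonneg : 0 ≤ ∑ n ∈ Icc 1 N, vonMangoldt n * vonMangoldt (n + h) :=
      sum_nonneg fun n _ ↦ mul_nonneg vonMangoldt_nonneg vonMangoldt_nonneg
    rw [Real.norm_of_nonneg hsum_nonneg, Real.norm_of_nonneg (by positivity)]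
    calc ∑ n ∈ Icc 1 N, vonMangoldt n * vonMangoldt (n + h)
          ≤ 2 * (Nat.log 2 (N + h) + 1) * L ^ 2 := sum_le_of_odd hh N
      _ ≤ 2 * (2 * L + 1) * L ^ 2 := by gcongr
      _ ≤ 6 * L ^ 3 := by nlinarith
  have hu : Tendsto (fun N : ℕ => ((N + h : ℕ) : ℝ)) atTop atTop :=
    tendsto_natCast_atTop_atTop.comp (tendsto_add_atTop_nat h)
  have hB : (fun N : ℕ => Real.log ((N + h : ℕ) : ℝ) ^ 3)
      =o[atTop] fun N : ℕ => ((N + h : ℕ) : ℝ) :=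
    (Real.isLittleO_pow_log_id_atTop (n := 3)).comp_tendsto hu
  have hC : (fun N : ℕ => ((N + h : ℕ) : ℝ)) =O[atTop] fun N : ℕ => (N : ℝ) := by
    refine IsBigO.of_bound 2 ?_
    filter_upwards [eventually_ge_atTop h] with N hN
    rw [Real.norm_of_nonneg (Nat.cast_nonneg _), Real.norm_of_nonneg (Nat.cast_nonneg _)]
    exact_mod_cast (by omega : N + h ≤ 2 * N)
  exact hA.trans_isLittleO (hB.trans_isBigO hC)

/-! ### Reduction of the item to even shifts -/

/-- **Reduction.** `PairsHL` (all shifts `h ≥ 1`) is equivalent to its restriction to EVEN shifts,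
the odd shifts being settled by `pairsHL_odd`. The even-shift case is the Hardy–Littlewood
prime-pair conjecture (`h = 2`: the twin-prime asymptotic), an open problem. [folklore] -/
theorem pairsHL_iff_even :
    PairsHL ↔ ∀ h : ℕ, Even h → 1 ≤ h →
      (fun N : ℕ => ∑ n ∈ Finset.Icc 1 N, ArithmeticFunction.vonMangoldt n *
          ArithmeticFunction.vonMangoldt (n + h)
          - Literature.NumberTheory.Sieve.singularSeries ({0, (h : ℤ)} : Finset ℤ) * N)
        =o[Filter.atTop] fun N : ℕ => (N : ℝ) := by
  refine ⟨fun H h _ hh ↦ H h hh, fun H h hh ↦ ?_⟩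
  rcases Nat.even_or_odd h with he | ho
  · exact H h he hh
  · exact pairsHL_odd ho

/-! ### Even shifts: admissibility and positivity of the singular series -/

/-- For even `h ≥ 1` (so `h ≥ 2`) the pair `{0, h}` has cardinality `2`. [folklore] -/
theorem card_pair_of_pos {h : ℕ} (hh : 1 ≤ h) : ({0, (h : ℤ)} : Finset ℤ).card = 2 :=
  card_pair (by exact_mod_cast (by omega : 0 ≠ h))

/-- For even `h ≥ 1` the pair `{0, h}` is admissible: it occupies one class mod `2` and at most
two classes mod every odd prime. [folklore] -/
theorem isAdmissibleTuple_pair_of_even {h : ℕ} (he : Even h) (hh : 1 ≤ h) :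
    IsAdmissibleTuple ({0, (h : ℤ)} : Finset ℤ) := by
  rw [isAdmissibleTuple_iff_of_le_card, card_pair_of_pos hh]
  intro p hp hp2
  obtain rfl : p = 2 := le_antisymm hp2 hp.two_le
  unfold tupleResidueCount
  rw [image_insert, image_singleton, Int.cast_zero, Int.cast_natCast,
    ZMod.natCast_eq_zero_iff_even.mpr he]
  decide

/-- For even `h ≥ 1`, `𝔖({0, h}) > 0`. [folklore] -/
theorem singularSeries_pair_pos_of_even {h : ℕ} (he : Even h) (hh : 1 ≤ h) :
    0 < singularSeries ({0, (h : ℤ)} : Finset ℤ) :=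
  (singularSeries_pos_iff_holds _).mpr (isAdmissibleTuple_pair_of_even he hh)

/-! ### Three elementary `eventually` estimates -/

/-- `log(N + h) ≤ (1 + δ) log N` for all large `N`. [folklore] -/
theorem eventually_log_add_le (h : ℕ) {δ : ℝ} (hδ : 0 < δ) :
    ∀ᶠ N : ℕ in atTop, Real.log ((N + h : ℕ) : ℝ) ≤ (1 + δ) * Real.log N := by
  have hlog : Tendsto (fun N : ℕ ↦ Real.log N) atTop atTop :=
    Real.tendsto_log_atTop.comp tendsto_natCast_atTop_atTop
  filter_upwards [hlog.eventually_ge_atTop (Real.log 2 / δ), eventually_ge_atTop (max h 1)]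
    with N hN hN'
  have hN0 : (0 : ℝ) < N := by exact_mod_cast (by omega : 0 < N)
  have hNh : ((N + h : ℕ) : ℝ) ≤ 2 * N := by exact_mod_cast (by omega : N + h ≤ 2 * N)
  have h2 : Real.log 2 ≤ δ * Real.log N := by
    have := (div_le_iff₀ hδ).mp hN
    linarith
  calc Real.log ((N + h : ℕ) : ℝ) ≤ Real.log (2 * N) :=
        Real.log_le_log (by exact_mod_cast (by omega : 0 < N + h)) hNh
    _ = Real.log 2 + Real.log N := Real.log_mul two_ne_zero hN0.ne'
    _ ≤ (1 + δ) * Real.log N := by linarith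

/-- `N^{1−δ} log² N ≤ δ N` for all large `N` (`log² = o(N^δ)`). [folklore] -/
theorem eventually_rpow_mul_log_sq_le {δ : ℝ} (hδ : 0 < δ) :
    ∀ᶠ N : ℕ in atTop, (N : ℝ) ^ (1 - δ) * Real.log N ^ 2 ≤ δ * N := by
  have h1 : (fun x : ℝ ↦ Real.log x ^ (2 : ℝ)) =o[atTop] fun x ↦ x ^ δ :=
    isLittleO_log_rpow_rpow_atTop 2 hδ
  have h2 := tendsto_natCast_atTop_atTop.eventually (h1.def hδ)
  filter_upwards [h2, eventually_ge_atTop 1] with N hN hN1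
  have hN0 : (0 : ℝ) < N := by exact_mod_cast hN1
  have hlog0 : 0 ≤ Real.log (N : ℝ) := Real.log_natCast_nonneg N
  rw [Real.norm_of_nonneg (Real.rpow_nonneg hlog0 _), Real.norm_of_nonneg (by positivity),
    Real.rpow_two] at hN
  calc (N : ℝ) ^ (1 - δ) * Real.log N ^ 2
      ≤ (N : ℝ) ^ (1 - δ) * (δ * (N : ℝ) ^ δ) := by gcongr
    _ = δ * ((N : ℝ) ^ (1 - δ) * (N : ℝ) ^ δ) := by ring
    _ = δ * N := by rw [← Real.rpow_add hN0, sub_add_cancel, Real.rpow_one]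

/-- The proper-prime-power bound is `o(N)`:
`2 (√(N+h) + 1)(log₂(N+h) + 1) log²(N+h) ≤ c N` for all large `N`. [folklore] -/
theorem eventually_properPower_bound_le (h : ℕ) {c : ℝ} (hc : 0 < c) :
    ∀ᶠ N : ℕ in atTop,
      2 * ((Nat.sqrt (N + h) + 1) * (Nat.log 2 (N + h) + 1)) * Real.log ((N + h : ℕ) : ℝ) ^ 2
        ≤ c * N := by
  have hu : Tendsto (fun N : ℕ ↦ ((N + h : ℕ) : ℝ)) atTop atTop :=
    tendsto_natCast_atTop_atTop.comp (tendsto_add_atTop_nat h)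
  have h1 : (fun x : ℝ ↦ Real.log x ^ (3 : ℝ)) =o[atTop] fun x ↦ x ^ (1 / 2 : ℝ) :=
    isLittleO_log_rpow_rpow_atTop 3 (by norm_num)
  have h2 := hu.eventually (h1.def (by positivity : 0 < c / 24))
  filter_upwards [h2, eventually_ge_atTop (max h 3)] with N hN hN'
  set M : ℕ := N + h with hMdef
  have hM3 : (3 : ℝ) ≤ M := by exact_mod_cast (by omega : 3 ≤ M)
  have hM0 : (0 : ℝ) < M := by linarith
  have hM2N : (M : ℝ) ≤ 2 * N := by exact_mod_cast (by omega : M ≤ 2 * N)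
  have hL1 : 1 ≤ Real.log (M : ℝ) := by
    have := Real.log_le_log (Real.exp_pos 1)
      ((show Real.exp 1 ≤ (3 : ℝ) by linarith [Real.exp_one_lt_d9]).trans hM3)
    rwa [Real.log_exp] at this
  set L := Real.log (M : ℝ) with hLdef
  have hsqrt1 : 1 ≤ Real.sqrt M := by
    rw [Real.le_sqrt (by norm_num) hM0.le]
    linarith
  have hsqrtN : (Nat.sqrt M : ℝ) ≤ Real.sqrt M := by
    rw [Real.le_sqrt (Nat.cast_nonneg _) hM0.le]
    exact_mod_cast Nat.sqrt_le' M
  have hlog2 : (Nat.log 2 M : ℝ) ≤ 2 * L := natLog_two_le M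
  have hmain : L ^ 3 ≤ c / 24 * Real.sqrt M := by
    rw [Real.norm_of_nonneg (Real.rpow_nonneg (by linarith) _),
      Real.norm_of_nonneg (Real.rpow_nonneg hM0.le _), ← Real.sqrt_eq_rpow] at hN
    have e : L ^ (3 : ℝ) = L ^ (3 : ℕ) := by exact_mod_cast Real.rpow_natCast L 3
    rwa [e] at hN
  calc 2 * ((((Nat.sqrt M : ℕ) : ℝ) + 1) * (((Nat.log 2 M : ℕ) : ℝ) + 1)) * L ^ 2
      ≤ 2 * ((2 * Real.sqrt M) * (3 * L)) * L ^ 2 := by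
        gcongr 2 * (?_ * ?_) * L ^ 2
        · linarith
        · linarith
    _ = 12 * Real.sqrt M * L ^ 3 := by ring
    _ ≤ 12 * Real.sqrt M * (c / 24 * Real.sqrt M) := by gcongr
    _ = c / 2 * (Real.sqrt M * Real.sqrt M) := by ring
    _ = c / 2 * M := by rw [Real.mul_self_sqrt hM0.le]
    _ ≤ c / 2 * (2 * N) := by gcongr
    _ = c * N := by ring

end Summit.Parity.GeneralizedHardyLittlewood.Theorems.PairsHL

end
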